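import Mathlib
import Summits.ValiantsHypothesis.ValiantsHypothesis.Theorems.LacunarySymmetroidMatrixDescartesCensusDefs
import Summits.ValiantsHypothesis.ValiantsHypothesis.Theorems.LacunarySymmetroidMatrixDescartesCensusBox20Reduce
import Summits.ValiantsHypothesis.ValiantsHypothesis.Theorems.KPlusLogSqLawWeakLiftingTowerGraftExponentHalving

/-!
# Tower graft line — EVERY FAR LEVEL IS ABSORBED BY THE `K`-LETTER CLASS (exponent halving towards any level)

Sequel to `…TowerGraftExponentHalving.lean` (same seat), LINE (B) `Cruxes/WeakLifting/Lines/tower_graft.lean` of the crux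
`WeakLifting` (stmt-ValiantsHypothesis-19561); calibration of S5 `TowerGraftLaw` against size-multiplication class laws.
NO stub is claimed.

There the constant corner `[[0,1],[1,L]]` of the three-block bordering was merged into a level-`0` letter, so only
DYADIC multiples `2ⁿ·dₗ` of a level were reached.  Here the corner is carried by an ARBITRARY letter `l₁` (level
`e = d l₁`) and cleared WITHOUT inversion (§1, any commutative ring): `M(c)·[[c·1, 0],[Y, 1]] = [[c·G + x²·L, B],[0, c·N]]`
with the polynomial multiplier `Y = [x·L; −x·1]` (`borderThree_mul_clear`), hence
`det M(c) · c^{m} = det (c·G + x²·L) · det (c·N)` (`det_borderThree_smul_mul`); with `c = X^e`, `x = X^b` and `e ≤ 2b`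
the monomial cancels in `ℝ[X]` and `det M = X^{2em} · det N · det (G + X^{2b−e}·L)` — same positive roots.  So (§2):
* `posRootLawOn_snoc_halve` ★: `d l₁ ≤ 2b → PosRootLawOn (3m) (K+1) B (d, b) → PosRootLawOn m (K+1) B (d, 2b − d l₁)` —
  ONE HALVING TOWARDS ANY EXISTING LEVEL costs one tripling of the size;
* `posRootLawOn_snoc_mul_of_le_two_pow` ★★: on a support through `0`, for every letter `l₁` and `j ≤ 2ⁿ`,
  `PosRootLawOn (3ⁿ·m) K B d → PosRootLawOn m (K+1) B (d, j·d l₁)` (binary descent on `j`: even steps halve towards `0`,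
  odd steps towards `d l₁`);
* `posRootLawOn_snoc_of_le_two_pow` ★★★ / `posRootLawOn_snoc_of_log`: ON A SUPPORT THROUGH THE LEVELS `0` AND `1` —
  every tower `0 = d₀ < 1 = d₁ < ⋯` of the line, the census towers `(0,1,3,20)`, `(0,1,5,25)` — EVERY far level `D` is
  absorbed: `ζ₊(m; d, D) ≤ ζ₊(3^{⌊log₂ D⌋+1}·m; d) ≤ ζ₊(3·D^{log₂3}·m; d)`.

READING FOR THE LINE (honest).  On supports through `0, 1` the one-letter graft law S5 at ANY far level `D` follows from a
size-MULTIPLICATION class law `ζ₊(N·m; d) ≤ F·ζ₊(m; d) + A` with `N = 3^{⌊log₂D⌋+1}` and the same `F, A`; at the tower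
threshold `D ≈ m·d_{K−1}` this is `N ≈ 3·(m·d_{K−1})^{1.585}`.  It is NOT discharged by S4d `TowerSizeDoubling` (guard
`IsTower (size) d` fails at these sizes; `log N` doublings at factor `2^C` give a factor polynomial in `m·d_{K−1}`, not
S5's `2^C·B + 2^{C·log₂²m}`).  What is gained is exact and hypothesis-free: the LETTER axis of the line is a sub-axis of
the SIZE axis for every far level (no dyadic restriction), every rank / signature / `B`, no additive term; conversely every
`(K+1)`-letter lower bound transfers to a `K`-letter lower bound at size `3^{⌊log₂D⌋+1}·m`.

HONEST FRAMING: exact identities and their budget-relative reading; nothing on S4/S4b/S4d/S4f/S5/S5ᴸ, TowerB, `WeakLifting`,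
Conjecture B, 18050 or VP ≠ VNP; zero crux credit.  Def-free; Mathlib + two census files + the prequel.  Seat: prover
val-sym-lift-p2 g21 (`prover-val-sym-lift-p2-g21-0`), `--supports stmt-ValiantsHypothesis-19561 --as helper`.
-/

-- `Summit.ValiantsHypothesis.ValiantsHypothesis.…` repeats a component by the D-0017 layout
-- (single-conjunct summit), which the `dupNamespace` linter flags; the name is mandated.
set_option linter.dupNamespace false

namespace Summit.ValiantsHypothesis.ValiantsHypothesis.Theorems.KPlusLogSqLaw.TowerGraft

open Finset Polynomial Matrix
open scoped BigOperators Polynomial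
open Summit.ValiantsHypothesis.ValiantsHypothesis.Theorems.LacunarySymmetroidMatrixDescartes (PosRootLawOn)

/-! ## §1 Clearing the corner at a general level without inverting it -/

section BorderLevel

variable {ι : Type*} [Fintype ι] [DecidableEq ι] {R : Type*} [CommRing R]

/-- clearing the bordered matrix with the corner at a scalar multiple `c • [[0,1],[1,L]]` by a polynomial (non-inverted)
multiplier: `M(c) · [[c·1, 0], [Y, 1]] = [[c·G + x²·L, B], [0, c·N]]` with `Y = [x·L; −x·1]`. [folklore] -/
theorem borderThree_mul_clear (G L : Matrix ι ι R) (x c : R) :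
    fromBlocks G (fromCols (x • (1 : Matrix ι ι R)) 0) (fromRows (x • (1 : Matrix ι ι R)) 0)
        (c • fromBlocks (0 : Matrix ι ι R) 1 1 L) *
      fromBlocks (c • (1 : Matrix ι ι R)) 0 (fromRows (x • L) (-(x • (1 : Matrix ι ι R)))) 1 =
    fromBlocks (c • G + (x * x) • L) (fromCols (x • (1 : Matrix ι ι R)) 0) 0
        (c • fromBlocks (0 : Matrix ι ι R) 1 1 L) := by
  rw [fromBlocks_multiply]
  congr 1
  · rw [fromCols_mul_fromRows, Matrix.mul_smul, Matrix.mul_one, smul_mul_assoc, Matrix.one_mul, smul_smul,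
      Matrix.zero_mul, add_zero]
  · rw [Matrix.mul_zero, Matrix.mul_one, zero_add]
  · rw [fromBlocks_smul, fromRows_mul, fromBlocks_mul_fromRows]
    simp only [Matrix.smul_mul, Matrix.mul_smul, Matrix.one_mul, Matrix.mul_one, Matrix.zero_mul, smul_zero,
      Matrix.mul_neg, smul_smul, mul_comm x c, zero_add]
    ext (i | i) j
    · simp [fromRows]
    · simp [fromRows]
  · rw [Matrix.mul_zero, Matrix.mul_one, zero_add]

/-- determinant form of the clearing: `det M(c) · c^{|ι|} = det (c·G + x²·L) · det (c • [[0,1],[1,L]])` — for `c` a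
non-zero-divisor this identifies `det M(c)` without inverting `c`. [folklore] -/
theorem det_borderThree_smul_mul (G L : Matrix ι ι R) (x c : R) :
    (fromBlocks G (fromCols (x • (1 : Matrix ι ι R)) 0) (fromRows (x • (1 : Matrix ι ι R)) 0)
        (c • fromBlocks (0 : Matrix ι ι R) 1 1 L)).det * c ^ Fintype.card ι =
      (c • G + (x * x) • L).det * (c • fromBlocks (0 : Matrix ι ι R) 1 1 L).det := by
  have h := congrArg Matrix.det (borderThree_mul_clear G L x c)
  have h1 : (c • (1 : Matrix ι ι R)).det = c ^ Fintype.card ι := by rw [det_smul, det_one, mul_one]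
  rw [det_mul, det_fromBlocks_zero₁₂, det_fromBlocks_zero₂₁, det_one, mul_one, h1] at h
  exact h

end BorderLevel

/-! ## §2 Halving towards any existing level; every multiple of a level, and every level on supports through `0, 1` -/

section HalvingLevel

variable {m K B : ℕ}

/-- the bordered letters with the constant corner merged into an ARBITRARY letter `l₁` (level `d l₁`): the pencil on
`Fin m ⊕ (Fin m ⊕ Fin m)` is the three-block bordering with corner `X^{d l₁} • [[0,1],[1,L]]`. [this work] -/
theorem borderThree_pencil_eq_level (d : Fin K → ℕ) (l₁ : Fin K) (b : ℕ)
    (S : Fin K → Matrix (Fin m) (Fin m) ℝ) (L : Matrix (Fin m) (Fin m) ℝ) :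
    (∑ l, (X : ℝ[X]) ^ (Fin.snoc d b : Fin (K + 1) → ℕ) l •
        ((Fin.snoc (α := fun _ => Matrix (Fin m ⊕ (Fin m ⊕ Fin m)) (Fin m ⊕ (Fin m ⊕ Fin m)) ℝ)
            (fun l => fromBlocks (S l) 0 0 ((if l = l₁ then (1 : ℝ) else 0) • fromBlocks 0 1 1 L))
            (fromBlocks 0 (fromCols 1 0) (fromRows 1 0) 0) l).map C)) =
      fromBlocks (∑ l, (X : ℝ[X]) ^ d l • (S l).map C)
        (fromCols ((X : ℝ[X]) ^ b • (1 : Matrix (Fin m) (Fin m) ℝ[X])) 0)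
        (fromRows ((X : ℝ[X]) ^ b • (1 : Matrix (Fin m) (Fin m) ℝ[X])) 0)
        ((X : ℝ[X]) ^ d l₁ • fromBlocks (0 : Matrix (Fin m) (Fin m) ℝ[X]) 1 1 (L.map C)) := by
  have hcorner : ∀ p q, (∑ x, C ((if x = l₁ then fromBlocks (0 : Matrix (Fin m) (Fin m) ℝ) 1 1 L else 0) p q) *
      (X : ℝ[X]) ^ d x) = (X : ℝ[X]) ^ d l₁ * C (fromBlocks (0 : Matrix (Fin m) (Fin m) ℝ) 1 1 L p q) := by
    intro p q
    rw [Finset.sum_eq_single l₁ (fun x _ hx => by rw [if_neg hx, Matrix.zero_apply, C_0, zero_mul])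
      (fun h => absurd (Finset.mem_univ _) h), if_pos rfl, mul_comm]
  refine Matrix.ext fun i j => ?_
  rw [Matrix.sum_apply, Fin.sum_univ_castSucc]
  simp only [Fin.snoc_castSucc, Fin.snoc_last, Matrix.smul_apply, Matrix.map_apply, smul_eq_mul]
  rcases i with i | i | i <;> rcases j with j | j | j <;>
    simp [Matrix.sum_apply, Matrix.one_apply, fromCols, fromRows, apply_ite C, hcorner]

open Summit.ValiantsHypothesis.ValiantsHypothesis.Theorems.LacunarySymmetroidMatrixDescartes.Census in
/-- **ONE HALVING TOWARDS ANY EXISTING LEVEL.**  For every letter index `l₁` and every `b` with `d l₁ ≤ 2b`: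
`PosRootLawOn (3m) (K+1) B (d, b) → PosRootLawOn m (K+1) B (d, 2b − d l₁)`, i.e. `ζ₊(m; d, D) ≤ ζ₊(3m; d, (D + d l₁)/2)`
whenever `D + d l₁` is even — the corner `[[0,1],[1,L]]` is now carried by the letter `l₁` at level `d l₁` and is cleared
WITHOUT inversion (`det_borderThree_smul_mul` with `c = X^{d l₁}`, then cancellation of the monomial in `ℝ[X]`).
Every rank and signature, no tower hypothesis, no additive term. [this work] -/
theorem posRootLawOn_snoc_halve (d : Fin K → ℕ) (l₁ : Fin K) (b : ℕ) (hb : d l₁ ≤ 2 * b)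
    (h : PosRootLawOn (m + (m + m)) (K + 1) B (Fin.snoc d b)) :
    PosRootLawOn m (K + 1) B (Fin.snoc d (2 * b - d l₁)) := by
  intro S hS
  set L : Matrix (Fin m) (Fin m) ℝ := S (Fin.last K) with hL
  set G : Matrix (Fin m) (Fin m) ℝ[X] := ∑ l, (X : ℝ[X]) ^ d l • (S (Fin.castSucc l)).map C with hG
  have hsplit : (∑ l, (X : ℝ[X]) ^ (Fin.snoc d (2 * b - d l₁) : Fin (K + 1) → ℕ) l • (S l).map C) =
      G + (X : ℝ[X]) ^ (2 * b - d l₁) • L.map C := by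
    rw [Fin.sum_univ_castSucc]
    simp only [Fin.snoc_castSucc, Fin.snoc_last, hG, hL]
  set T : Fin (K + 1) → Matrix (Fin m ⊕ (Fin m ⊕ Fin m)) (Fin m ⊕ (Fin m ⊕ Fin m)) ℝ :=
    Fin.snoc (α := fun _ => Matrix (Fin m ⊕ (Fin m ⊕ Fin m)) (Fin m ⊕ (Fin m ⊕ Fin m)) ℝ)
      (fun l => fromBlocks (S (Fin.castSucc l)) 0 0 ((if l = l₁ then (1 : ℝ) else 0) • fromBlocks 0 1 1 L))
      (fromBlocks 0 (fromCols 1 0) (fromRows 1 0) 0) with hT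
  set e : Fin m ⊕ (Fin m ⊕ Fin m) ≃ Fin (m + (m + m)) :=
    (Equiv.sumCongr (Equiv.refl (Fin m)) finSumFinEquiv).trans finSumFinEquiv with he
  have hTsymm : ∀ l, (T l).IsSymm := by
    intro l
    refine Fin.lastCases ?_ (fun l => ?_) l
    · simp only [hT, Fin.snoc_last]
      rw [Matrix.IsSymm, fromBlocks_transpose, transpose_zero, transpose_zero, transpose_fromCols,
        transpose_fromRows, transpose_one, transpose_zero]
    · simp only [hT, Fin.snoc_castSucc]
      rw [Matrix.IsSymm, fromBlocks_transpose, transpose_zero, transpose_zero, (hS _).eq, transpose_smul,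
        fromBlocks_transpose, transpose_zero, transpose_one, (hS _).eq]
  have hB := h (fun l => Matrix.reindex e e (T l)) (fun l => (hTsymm l).submatrix _)
  have hpencil := borderThree_pencil_eq_level (m := m) d l₁ b (fun l => S (Fin.castSucc l)) L
  -- determinant bookkeeping
  have hdetN : (fromBlocks (0 : Matrix (Fin m) (Fin m) ℝ) 1 1 L).det ≠ 0 :=
    left_ne_zero_of_mul_eq_one (det_borderThree_mul L)
  have hNmap : (fromBlocks (0 : Matrix (Fin m) (Fin m) ℝ) 1 1 L).map C =
      fromBlocks (0 : Matrix (Fin m) (Fin m) ℝ[X]) 1 1 (L.map C) := by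
    rw [fromBlocks_map, Matrix.map_one C C_0 C_1, Matrix.map_zero C C_0]
  have hdetN' : (fromBlocks (0 : Matrix (Fin m) (Fin m) ℝ[X]) 1 1 (L.map C)).det =
      C (fromBlocks (0 : Matrix (Fin m) (Fin m) ℝ) 1 1 L).det := by
    rw [← hNmap, RingHom.map_det, RingHom.mapMatrix_apply]
  have hXe : ((X : ℝ[X]) ^ d l₁) ^ m ≠ 0 := pow_ne_zero _ (pow_ne_zero _ X_ne_zero)
  have hclear := det_borderThree_smul_mul G (L.map C) ((X : ℝ[X]) ^ b) ((X : ℝ[X]) ^ d l₁)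
  have hfactor : (X : ℝ[X]) ^ d l₁ • G + ((X : ℝ[X]) ^ b * (X : ℝ[X]) ^ b) • L.map C =
      (X : ℝ[X]) ^ d l₁ • (G + (X : ℝ[X]) ^ (2 * b - d l₁) • L.map C) := by
    rw [smul_add, smul_smul, ← pow_add, ← pow_add, ← two_mul, Nat.add_sub_cancel' hb]
  rw [hfactor, det_smul, det_smul, Fintype.card_fin, Fintype.card_sum, Fintype.card_fin, hdetN'] at hclear
  -- `hclear : det M * (X^e)^m = (X^e)^m * det (G + X^D L) * ((X^e)^(m+m) * C det N)`
  have hdet : (∑ l, (X : ℝ[X]) ^ (Fin.snoc d b : Fin (K + 1) → ℕ) l • (Matrix.reindex e e (T l)).map C).det =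
      (X : ℝ[X]) ^ (d l₁ * (m + m)) * (C (fromBlocks (0 : Matrix (Fin m) (Fin m) ℝ) 1 1 L).det *
        (G + (X : ℝ[X]) ^ (2 * b - d l₁) • L.map C).det) := by
    rw [sum_smul_map_reindex, Matrix.det_reindex_self, hT, hpencil]
    refine mul_right_cancel₀ hXe ?_
    rw [hclear, ← pow_mul]
    ring
  have hroots := posRoots_X_pow_mul_eq (d l₁ * (m + m))
    (C (fromBlocks (0 : Matrix (Fin m) (Fin m) ℝ) 1 1 L).det * (G + (X : ℝ[X]) ^ (2 * b - d l₁) • L.map C).det)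
  rw [Polynomial.roots_C_mul _ hdetN, ← hdet] at hroots
  rw [hsplit, ← hroots]
  exact hB

/-- **EVERY MULTIPLE OF AN EXISTING LEVEL IS ABSORBED.**  On a support `d` containing the level `0` (letter `l₀`), for
every letter `l₁`, every `n` and every `j ≤ 2ⁿ`: `PosRootLawOn (3ⁿ·m) K B d → PosRootLawOn m (K+1) B (d, j·d l₁)` —
`ζ₊(m; d, j·d_{l₁}) ≤ ζ₊(3ⁿ·m; d)`.  Binary descent on `j`: an even `j = 2i` halves towards the level `0`, an odd
`j = 2i+1` halves towards the level `d l₁` (`(j·d_{l₁} + d_{l₁})/2 = (i+1)·d_{l₁}`); at `j ≤ 1` the far letter sits at an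
existing level and merges (`posRootLawOn_snoc_self`). [this work] -/
theorem posRootLawOn_snoc_mul_of_le_two_pow (d : Fin K → ℕ) (l₀ : Fin K) (hl₀ : d l₀ = 0) (l₁ : Fin K) (n : ℕ) :
    ∀ {m : ℕ} (j : ℕ), j ≤ 2 ^ n → PosRootLawOn (3 ^ n * m) K B d →
      PosRootLawOn m (K + 1) B (Fin.snoc d (d l₁ * j)) := by
  induction n with
  | zero =>
    intro m j hj h
    rw [pow_zero, one_mul] at h
    rw [pow_zero] at hj
    rcases Nat.le_one_iff_eq_zero_or_eq_one.mp hj with rfl | rfl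
    · rw [mul_zero, ← hl₀]
      exact posRootLawOn_snoc_self d l₀ h
    · rw [mul_one]
      exact posRootLawOn_snoc_self d l₁ h
  | succ n ih =>
    intro m j hj h
    have h3 : PosRootLawOn (3 ^ n * (m + (m + m))) K B d := by
      have e3 : 3 ^ (n + 1) * m = 3 ^ n * (m + (m + m)) := by ring
      rw [e3] at h
      exact h
    obtain ⟨i, rfl | rfl⟩ := Nat.even_or_odd' j
    · have hi : i ≤ 2 ^ n := by rw [pow_succ] at hj; omega
      have step := posRootLawOn_snoc_halve d l₀ (d l₁ * i) (by rw [hl₀]; exact Nat.zero_le _) (ih i hi h3)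
      rw [hl₀, Nat.sub_zero] at step
      rw [show d l₁ * (2 * i) = 2 * (d l₁ * i) by ring]
      exact step
    · have hi : i + 1 ≤ 2 ^ n := by rw [pow_succ] at hj; omega
      have step := posRootLawOn_snoc_halve d l₁ (d l₁ * (i + 1)) (by nlinarith) (ih (i + 1) hi h3)
      rw [show 2 * (d l₁ * (i + 1)) - d l₁ = d l₁ * (2 * i + 1) by
        rw [show 2 * (d l₁ * (i + 1)) = d l₁ * (2 * i + 1) + d l₁ by ring, Nat.add_sub_cancel]] at step
      exact step

/-- **HEADLINE — ON A SUPPORT THROUGH THE LEVELS `0` AND `1`, EVERY FAR LETTER IS ABSORBED BY THE `K`-LETTER CLASS:**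
`ζ₊(m; d, D) ≤ ζ₊(3ⁿ·m; d)` for every `D ≤ 2ⁿ` — the `(K+1)`-letter class with an ARBITRARY far level `D` at size `m` is
bounded by the `K`-letter class on the same support at size `3^{⌈log₂ D⌉}·m ≤ 3·D^{log₂ 3}·m`.  (Towers `0 = d₀ < 1 = d₁ <
d₂ < ⋯` of the line, e.g. the census towers `(0,1,3,20)`, `(0,1,5,25)`, qualify; a support through `0` and `g` absorbs
every multiple of `g`, `posRootLawOn_snoc_mul_of_le_two_pow`.)  READING: S5 (`TowerGraftLaw`, one more letter at ANY far
level) on such supports FOLLOWS from any size-multiplication class law `ζ₊(N·m; d) ≤ F(N)·ζ₊(m; d) + A(N, m)` with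
`N = 3^{⌈log₂ D⌉}`; it is NOT discharged by S4d (tower guard at the large sizes; factor `F` polynomial in `D`).  Zero stub
credit. [this work] -/
theorem posRootLawOn_snoc_of_le_two_pow (d : Fin K → ℕ) (l₀ l₁ : Fin K) (hl₀ : d l₀ = 0) (hl₁ : d l₁ = 1) (n : ℕ)
    {m : ℕ} (D : ℕ) (hD : D ≤ 2 ^ n) (h : PosRootLawOn (3 ^ n * m) K B d) :
    PosRootLawOn m (K + 1) B (Fin.snoc d D) := by
  have := posRootLawOn_snoc_mul_of_le_two_pow (B := B) d l₀ hl₀ l₁ n D hD h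
  rwa [hl₁, one_mul] at this

/-- the same with the size written through `Nat.log 2 D`: `ζ₊(m; d, D) ≤ ζ₊(3^{log₂ D + 1}·m; d)` for EVERY `D`. [this work] -/
theorem posRootLawOn_snoc_of_log (d : Fin K → ℕ) (l₀ l₁ : Fin K) (hl₀ : d l₀ = 0) (hl₁ : d l₁ = 1) {m : ℕ} (D : ℕ)
    (h : PosRootLawOn (3 ^ (Nat.log 2 D + 1) * m) K B d) : PosRootLawOn m (K + 1) B (Fin.snoc d D) :=
  posRootLawOn_snoc_of_le_two_pow d l₀ l₁ hl₀ hl₁ (Nat.log 2 D + 1) D (Nat.lt_pow_succ_log_self one_lt_two D).le h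

end HalvingLevel


end Summit.ValiantsHypothesis.ValiantsHypothesis.Theorems.KPlusLogSqLaw.TowerGraft
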